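import Summits.PneNP.PneNP.Theorems.ConvexRankGatesConvexGateBlindExactLiftingTriangleLineRepUnique

/-!
# Triangle instance — the row space of `M_t` contains non-negative functions outside `cone{1_L}`

Support file for crux `ConvexGateBlind` (stmt-PneNP-10680), open stub `stub_exactLifting`; prover seat 0, session 36,
memo ANALYSIS15 §3. Calibration of regrouping rigidity (`…TriangleRegroupingRigidity`: generators in `cone{1_L}` are rigid):
the class "generators in `cone{1_L}`" is STRICTLY SMALLER than the class "non-negative generators in the row space
`span{1_L}`" (= restricted non-negative rank in the sense of Gillis–Glineur). Witness: for every nondegenerate row `x` the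
indicator `m_x` of its monochromatic triangles,
* lies in `span{1_L}`: `m_x = (M_x − 1)/2 = Σ_L ([L mono_x] − [L of direction (a,b,·)])/2 · 1_L` (the `t²` lines of one
  direction sum to the constant `1`) — `monoInd_eq_sum_lines`;
* is non-negative and non-zero, but is NOT a non-negative combination of line indicators: a line inside the support of
  `m_x` would have all its `t` triangles monochromatic, forcing a monochromatic block — `monoInd_not_cone`.
(Exact LP at `t = 3`: random vertices of `{g ∈ span{1_L} : g ≥ 0, Σ g = 1}` outside the cone appear in ~1/8 of the trials,
work/s36/cone_vs_span.py.) So R1* (generators of a `3t²`-term NMF of `M_t` lie in `cone{1_L}`) does not reduce to a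
row-space statement for free; "row-space generators are rigid" is a genuinely intermediate open question.
Registered sub-goal `triangle_monoset_not_cone` (self-contained signature).
-/

set_option linter.dupNamespace false -- `Summit.PneNP.PneNP.…`: summit = sub-problem (D-0017)

namespace Summit.PneNP.PneNP.Theorems.XorDoor.TriLine

open Finset

noncomputable section

variable {t : ℕ}

/-- indicator of the monochromatic triangles of the row `x` -/
def monoInd (x : Col t) (w : Tri t) : ℝ := if IsMono x w.1 w.2.1 w.2.2 then 1 else 0

/-- `M_x = 1 + 2 m_x` -/
lemma monoCount_eq_monoInd (x : Col t) (w : Tri t) : (monoCount x w : ℝ) = 1 + 2 * monoInd x w := by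
  obtain ⟨a, b, d⟩ := w
  unfold monoInd
  by_cases h : IsMono x a b d
  · rw [monoCount_of_isMono h, if_pos h]; norm_num
  · rw [monoCount_of_not_isMono h, if_neg h]; norm_num

/-- the `t²` lines of direction `(a,b,·)` sum to the constant function `1` -/
lemma sum_lind_inl_dir (w : Tri t) : ∑ ab : Fin t × Fin t, lind (Sum.inl ab) w = 1 := by
  rw [Fintype.sum_eq_single (w.1, w.2.1)]
  · unfold lind; rw [if_pos]; exact ⟨rfl, rfl⟩
  · rintro ⟨a, b⟩ h
    unfold lind; rw [if_neg]
    rintro ⟨ha, hb⟩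
    exact h (by rw [ha, hb])

/-- indicator of "the line has direction `(a,b,·)`" -/
def dirOne (L : Line t) : ℝ := Sum.elim (fun _ => 1) (fun _ => 0) L

/-- **`m_x` lies in the span of the line indicators**: `m_x = Σ_L ([L mono_x] − [L of the first direction])/2 · 1_L`. -/
theorem monoInd_eq_sum_lines (x : Col t) (w : Tri t) :
    monoInd x w = ∑ L : Line t, (mInd x L - dirOne L) / 2 * lind L w := by
  have h1 : ∑ L : Line t, mInd x L * lind L w = (monoCount x w : ℝ) := sum_mInd_mul_lind x w
  have h2 : ∑ L : Line t, dirOne L * lind L w = 1 := by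
    rw [Fintype.sum_sum_type, Fintype.sum_sum_type]
    simp only [dirOne, Sum.elim_inl, Sum.elim_inr, one_mul, zero_mul, sum_const_zero, add_zero]
    exact sum_lind_inl_dir w
  have h3 : ∑ L : Line t, (mInd x L - dirOne L) / 2 * lind L w =
      (∑ L : Line t, mInd x L * lind L w - ∑ L : Line t, dirOne L * lind L w) / 2 := by
    rw [← sum_sub_distrib, sum_div]
    exact sum_congr rfl fun L _ => by ring
  rw [h3, h1, h2, monoCount_eq_monoInd]; ring

/-- a nondegenerate row has a monochromatic triangle -/
lemma exists_isMono (x : Col t) (hx : mu x ≠ 0) (a : Fin t) : ∃ b d, IsMono x a b d := by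
  obtain ⟨-, ⟨b, b', hb⟩, ⟨d, d', hd⟩⟩ := (mu_ne_zero_iff_two_coloured x).1 hx
  obtain ⟨⟨b₀, hb₀⟩, -⟩ := exists_eq_and_ne hb (x.1 a)
  obtain ⟨⟨d₀, hd₀⟩, -⟩ := exists_eq_and_ne hd (x.1 a)
  exact ⟨b₀, d₀, hb₀.symm, hd₀.symm⟩

/-- no line lies inside the monochromatic triangles of a nondegenerate row -/
lemma exists_not_isMono_on_line (x : Col t) (hx : mu x ≠ 0) (L : Line t) : ∃ w, lmem L w ∧ ¬ IsMono x w.1 w.2.1 w.2.2 := by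
  obtain ⟨⟨a, a', ha⟩, ⟨b, b', hb⟩, ⟨d, d', hd⟩⟩ := (mu_ne_zero_iff_two_coloured x).1 hx
  rcases L with ⟨a₀, b₀⟩ | ⟨a₀, d₀⟩ | ⟨b₀, d₀⟩
  · obtain ⟨-, ⟨d₁, hd₁⟩⟩ := exists_eq_and_ne hd (x.1 a₀)
    exact ⟨(a₀, b₀, d₁), ⟨rfl, rfl⟩, fun h => hd₁ h.2.symm⟩
  · obtain ⟨-, ⟨b₁, hb₁⟩⟩ := exists_eq_and_ne hb (x.1 a₀)
    exact ⟨(a₀, b₁, d₀), ⟨rfl, rfl⟩, fun h => hb₁ h.1.symm⟩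
  · obtain ⟨-, ⟨a₁, ha₁⟩⟩ := exists_eq_and_ne ha (x.2.1 b₀)
    exact ⟨(a₁, b₀, d₀), ⟨rfl, rfl⟩, fun h => ha₁ h.1⟩

/-- **`m_x` is not a non-negative combination of line indicators** (nondegenerate `x`). -/
theorem monoInd_not_cone (x : Col t) (hx : mu x ≠ 0) :
    ¬ ∃ c : Line t → ℝ, (∀ L, 0 ≤ c L) ∧ ∀ w, monoInd x w = ∑ L, c L * lind L w := by
  rintro ⟨c, hc, hrep⟩
  -- every coefficient vanishes: a line with `c_L > 0` would lie inside the monochromatic triangles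
  have hzero : ∀ L, c L = 0 := by
    intro L
    by_contra hne
    have hpos : 0 < c L := lt_of_le_of_ne (hc L) (Ne.symm hne)
    obtain ⟨w, hw, hnm⟩ := exists_not_isMono_on_line x hx L
    have h0 : monoInd x w = 0 := by unfold monoInd; rw [if_neg hnm]
    have hle : c L * lind L w ≤ ∑ L', c L' * lind L' w :=
      single_le_sum (f := fun L' => c L' * lind L' w)
        (fun L' _ => mul_nonneg (hc L') (by unfold lind; split_ifs <;> norm_num)) (mem_univ L)
    rw [← hrep w, h0] at hle
    have hl : lind L w = 1 := by unfold lind; rw [if_pos hw]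
    rw [hl, mul_one] at hle
    linarith
  -- but `m_x ≠ 0`
  obtain ⟨a⟩ : Nonempty (Fin t) := by
    obtain ⟨⟨a, -, -⟩, -, -⟩ := (mu_ne_zero_iff_two_coloured x).1 hx
    exact ⟨a⟩
  obtain ⟨b, d, hm⟩ := exists_isMono x hx a
  have h1 : monoInd x (a, b, d) = 1 := by unfold monoInd; rw [if_pos hm]
  rw [hrep (a, b, d), sum_eq_zero fun L _ => by rw [hzero L, zero_mul]] at h1
  exact zero_ne_one h1

/-- **Row-space generators need not be line-regroupings** (registered sub-goal `triangle_monoset_not_cone` of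
stmt-PneNP-10680, verbatim signature, self-contained vocabulary): for every row `x` two-coloured on every block, the indicator
of its monochromatic transversal triangles is a REAL combination of the `3t²` line indicators (lines
`(Fin t × Fin t) ⊕ (Fin t × Fin t) ⊕ (Fin t × Fin t)`, membership written out with `Sum.elim`) but NOT a non-negative one. -/
theorem triangle_monoset_not_cone : ∀ (t : ℕ) (x : (Fin t → Bool) × (Fin t → Bool) × (Fin t → Bool)), ((∃ a a', x.1 a ≠
    x.1 a') ∧ (∃ b b', x.2.1 b ≠ x.2.1 b') ∧ (∃ d d', x.2.2 d ≠ x.2.2 d')) → (∃ c : (Fin t × Fin t) ⊕ (Fin t × Fin t) ⊕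
    (Fin t × Fin t) → ℝ, ∀ w : Fin t × Fin t × Fin t, (if x.1 w.1 = x.2.1 w.2.1 ∧ x.1 w.1 = x.2.2 w.2.2 then (1 : ℝ)
    else 0) = ∑ L, c L * Sum.elim (fun ab : Fin t × Fin t => if w.1 = ab.1 ∧ w.2.1 = ab.2 then (1 : ℝ) else 0)
    (Sum.elim (fun ad : Fin t × Fin t => if w.1 = ad.1 ∧ w.2.2 = ad.2 then (1 : ℝ) else 0) (fun bd : Fin t × Fin t =>
    if w.2.1 = bd.1 ∧ w.2.2 = bd.2 then (1 : ℝ) else 0)) L) ∧ ¬ ∃ c : (Fin t × Fin t) ⊕ (Fin t × Fin t) ⊕ (Fin t × Fin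
    t) → ℝ, (∀ L, 0 ≤ c L) ∧ ∀ w : Fin t × Fin t × Fin t, (if x.1 w.1 = x.2.1 w.2.1 ∧ x.1 w.1 = x.2.2 w.2.2 then (1 :
    ℝ) else 0) = ∑ L, c L * Sum.elim (fun ab : Fin t × Fin t => if w.1 = ab.1 ∧ w.2.1 = ab.2 then (1 : ℝ) else 0)
    (Sum.elim (fun ad : Fin t × Fin t => if w.1 = ad.1 ∧ w.2.2 = ad.2 then (1 : ℝ) else 0) (fun bd : Fin t × Fin t =>
    if w.2.1 = bd.1 ∧ w.2.2 = bd.2 then (1 : ℝ) else 0)) L := by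
  intro t x hx2
  have hx : mu x ≠ 0 := (mu_ne_zero_iff_two_coloured x).2 hx2
  have hmono : ∀ w : Tri t, (if x.1 w.1 = x.2.1 w.2.1 ∧ x.1 w.1 = x.2.2 w.2.2 then (1 : ℝ) else 0) = monoInd x w :=
    fun w => rfl
  constructor
  · refine ⟨fun L => (mInd x L - dirOne L) / 2, fun w => ?_⟩
    rw [hmono, monoInd_eq_sum_lines]
    exact sum_congr rfl fun L _ => by rw [lind_eq_elim]
  · rintro ⟨c, hc, hrep⟩
    refine monoInd_not_cone x hx ⟨c, hc, fun w => ?_⟩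
    rw [← hmono, hrep w]
    exact sum_congr rfl fun L _ => by rw [← lind_eq_elim]

end

end Summit.PneNP.PneNP.Theorems.XorDoor.TriLine
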